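import Summits.QuantumFields.BalabanUV.T4Continuum.Support.NE9CurveSpeciesWitness
import Summits.QuantumFields.BalabanUV.T4Continuum.Support.NE9Lemma1CurveSpeciesAdditive

/-!
# NE9CurveSpeciesWitnessAdditive — S3 ∧ S4 ∧ S5 FIRE on the NON-LINEAR toy curve datum: crew row (w19)'s `sBinders_cur` APPLIED to
# CUR-WITNESS's `wCur γ` (cell `pub-balaban`, T4-DAG §2 node U3 ∕ §6 NE9; NE9 formalisation swarm, unit
# `b2b-balaban-t4-ne9-formalise-leaf-06` gen 8, follow-through of «CUR-WITNESS» p215223 announced CLAIMS.log l.11165 ∕ l.11195 ∕ l.11330)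

HONEST FRAMING (T4-DAG PAGE 1).  Rung (B)+1 of the FINITE-VOLUME T⁴ programme — NOT infinite volume, NOT a mass gap, NOT the
Clay problem.  NE9 (`T4OutputRate.NE9` ∧ `FadingMemory`) is a cell NEW ESTIMATE, NOT PRINTED, NOT discharged here; spine 0/9;
0/18 skeleton leaves instantiated on Bałaban's objects (O-NE9-1) — a TOY instantiates NO leaf.  HONEST DEPENDENCY (cell line,
verbatim): continuum YM on T⁴ ⇐ BetaPertH ∧ nine spine estimates (0/9 proved); BetaPertH ⇐ (D1) ∧ (D4) ∧ CAP+tail; G-an2-4 gates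
asym, D1 and NE2/3/4.  `FlowStep.BetaPertH`, (B), (B^μ) do not occur.  Nothing of [I] = [Balaban1987RG1] ∕ [II] =
[Balaban1988RG2Cluster] is quoted as a hypothesis.

WHY A SEPARATE FILE.  `NE9CurveSpeciesWitness` (p215223) exhibited the toy curve datum `wCur γ` — slice curve
`clamp_{1∕16}(t)·clamp_γ(s k)·(τ + τ²∕2)`, NOT the curve reading of any ray datum (`toCur_ne_wCur`) — met `CurData.Admissible`, the
level counts, leaf A3's (c1)–(c3), and crew row (w19)'s slice-curve regularity pair IN ITS EXACT SHAPE (`cur_analytic_wCur` =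
`hcurA`, `cur_jointContinuous_wCur` = `hcurC`), and fired S4 ∧ S5 and A3-CUR; S3 (`ChannelAdditive`) was left displayed because
(w19) `NE9Lemma1CurveSpeciesAdditive` (AUTHOR leaf-08-g4; p214120, in the tree as the courier re-file p215330) had not yet
committed.  It has now; this file applies its `sBinders_cur` BY NAME, keeping p215223 byte-frozen.

WHAT IS PROVED (kernel, `[folklore]`; 0 sorry, 0 def).  §1 **`pieceAdditive_witness_cur`** — `PieceAdditiveOn (analyticClass
(wCur γ).R) (wCur γ).toC` ((w19)'s `pieceAdditiveOn_cur` APPLIED: the toy (1.23)-pieces of the fifth-order remainder along the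
QUADRATIC slice curves are subtractive in the old term on the analytic class); **`sBinders_witness_cur`** — (w19)'s `sBinders_cur`
APPLIED: `ChannelAdditive` ∧ `ChannelLocal` ∧ `ChannelStepSum` ∧ `ChannelSizeAtStepNN` for the toy channel `cpieceChannel (wCur γ).toC`
on its analytic class with the weight `weightOf … 1 0 2 ((wCur γ).Kp (1∕4))` and the profile `tauOfG 1 (agePow ω)` — so ALL FOUR
channel-structure binders S3–S5 of the NE9 END hold simultaneously on a curve datum outside the ray sub-case, every hypothesis
discharged by p215223's §2.  §2 `example`: the S4 ∧ S5 part agrees with p215223's `sizeBinders_witness_cur` (same statement).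
DISGUISE TEST: a toy datum; producers applied by name — not NE9, not an instantiation, nothing of Bałaban's curves claimed.
-/

noncomputable section

namespace Summit.QuantumFields.BalabanUV.T4Continuum.NE9CurveSpeciesWitnessAdditive

open Literature.MathematicalPhysics.QuantumFieldTheory.Balaban1983to89
open Literature.MathematicalPhysics.QuantumFieldTheory.Balaban1983to89.T4HistoryLipschitzRecursion
open Summit.QuantumFields.BalabanUV.T4Continuum.NE9Lemma1Counting
open Summit.QuantumFields.BalabanUV.T4Continuum.NE9Lemma1Gain
open Summit.QuantumFields.BalabanUV.T4Continuum.NE9Lemma1PieceClass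
open Summit.QuantumFields.BalabanUV.T4Continuum.NE9Lemma1RemainderSpecies
open Summit.QuantumFields.BalabanUV.T4Continuum.NE9Lemma1CurveSpecies
open Summit.QuantumFields.BalabanUV.T4Continuum.NE9Lemma1CurveSpeciesAdditive (pieceAdditiveOn_cur sBinders_cur)
open Summit.QuantumFields.BalabanUV.T4Continuum.NE9CurveSpeciesWitness

/-! ## §1 (w19) fires on the toy curve datum -/

/-- **(w19)'s `pieceAdditiveOn_cur` FIRES ON THE TOY (kernel)**: the (1.23)-pieces of the toy curve species — fifth-order remainders
along the QUADRATIC slice curves `wCurve γ` — are subtractive in the old term on the analytic class; hypotheses `0 < κ₁ = 1`,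
`0 < r_k = 1∕16`, `1 < ϱ = 4` and the regularity pair `cur_analytic_wCur` ∕ `cur_jointContinuous_wCur` of p215223. [folklore] -/
theorem pieceAdditive_witness_cur {γ : ℝ} (hγ0 : 0 ≤ γ) (hγ1 : γ ≤ 1) :
    PieceAdditiveOn (analyticClass (wCur γ).R) (wCur γ).toC :=
  pieceAdditiveOn_cur (wCur γ) (lt_of_lt_of_le one_pos (admissible_wCur hγ0 hγ1).κ₁_ge) (admissible_wCur hγ0 hγ1).r_pos
    (admissible_wCur hγ0 hγ1).ϱ_gt (cur_analytic_wCur hγ0 hγ1) (cur_jointContinuous_wCur γ)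

/-- **ALL FOUR S-BINDERS FIRE ON THE TOY CURVE DATUM (kernel)**: crew row (w19)'s `NE9Lemma1CurveSpeciesAdditive.sBinders_cur`
(AUTHOR leaf-08-g4, p215330) APPLIED to `wCur γ` — S3 `ChannelAdditive` ∧ S4 `ChannelLocal` ∕ `ChannelStepSum` ∧ S5
`ChannelSizeAtStepNN` for `cpieceChannel (wCur γ).toC` on `analyticClass (wCur γ).R`, weight `weightOf … κ₁ 0 2 ((wCur γ).Kp (1∕4))`,
profile `tauOfG 1 (agePow ω)`; every hypothesis (`Admissible`, `ℓ ≥ 0`, the level counts, `0 ≤ O1`, `0 ≤ c_Q·ℓ′`, `hcurA`, `hcurC`)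
DISCHARGED by p215223 §2 — the curve species' S-side binder set is jointly inhabited OUTSIDE the ray sub-case. [folklore] -/
theorem sBinders_witness_cur {γ : ℝ} (hγ0 : 0 ≤ γ) (hγ1 : γ ≤ 1) (κ : ℝ) {ω : ℝ} (hω : 0 ≤ ω) :
    ChannelAdditive (analyticClass (wCur γ).R) (cpieceChannel (wCur γ).toC) ∧
      ChannelLocal (analyticClass (wCur γ).R) (cpieceChannel (wCur γ).toC) ∧
      ChannelStepSum (analyticClass (wCur γ).R) (cpieceChannel (wCur γ).toC) ∧
      ChannelSizeAtStepNN (analyticClass (wCur γ).R) (cpieceChannel (wCur γ).toC) κ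
        (weightOf (wCur γ).toC.frame (wCur γ).κ₁ 0 2 ((wCur γ).Kp (1 / 4))) (tauOfG 1 (agePow ω)) :=
  sBinders_cur (admissible_wCur hγ0 hγ1) (fun _ _ => zero_le_one) κ (levelCountsG_wCur γ κ hω) (by norm_num)
    (fun k j => by simpa using agePow_nonneg hω k j) (cur_analytic_wCur hγ0 hγ1) (cur_jointContinuous_wCur γ)

/-! ## §2 Consistency with p215223's S4 ∧ S5 firing -/

/-- The S4 ∧ S5 components of `sBinders_witness_cur` are p215223's `sizeBinders_witness_cur` (same statement; by name). [folklore] -/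
example {γ : ℝ} (hγ0 : 0 ≤ γ) (hγ1 : γ ≤ 1) (κ : ℝ) {ω : ℝ} (hω : 0 ≤ ω) :
    ChannelLocal (analyticClass (wCur γ).R) (cpieceChannel (wCur γ).toC) ∧
      ChannelStepSum (analyticClass (wCur γ).R) (cpieceChannel (wCur γ).toC) ∧
      ChannelSizeAtStepNN (analyticClass (wCur γ).R) (cpieceChannel (wCur γ).toC) κ
        (weightOf (wCur γ).toC.frame (wCur γ).κ₁ 0 2 ((wCur γ).Kp (1 / 4))) (tauOfG 1 (agePow ω)) :=
  ⟨(sBinders_witness_cur hγ0 hγ1 κ hω).2.1, (sBinders_witness_cur hγ0 hγ1 κ hω).2.2.1, (sizeBinders_witness_cur hγ0 hγ1 κ hω).2.2⟩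

end Summit.QuantumFields.BalabanUV.T4Continuum.NE9CurveSpeciesWitnessAdditive

end
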